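import Summits.HodgeConjecture.CorCM.Census.GroupFreeFaceCoordinates
import Summits.HodgeConjecture.CorCM.FaceBasisDictionary
import Summits.HodgeConjecture.CorCM.FaceCensusTransport
import HarnessLib

/-!
# INT-2 with NO census: for EVERY Galois CM field `F` of degree `2n`, the `2^{n−1} − n` basis faces `F(𝟙_Q; i_Q, j_Q)` generate
# the Weil characters of all faces (`hgen`), so ONE period witness on each of them gives the Hodge conjecture for the `F`-slice

COR-CM (cell `pub-hodgecm2`), count-neutral kernel combinatorics by the binder seat b09 (gen 27; lane GROUP-FREE-FACE-BASIS, André-3's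
ask A6-R46), part V, sequel of `CorCM/FaceBasisDictionary.lean` (the dictionary `vecOf T₀ : ℤ[types] ≃ ℤ^{Ty (Pl T₀)}`) and of
`Census/GroupFreeFaceBasis.lean` / `Census/GroupFreeFaceCoordinates.lean` (the face basis: `H = P ⊔ ℤ⟨F(𝟙_Q; i_Q, j_Q)⟩`,
`|BIdx| + n = 2^{n−1}`).  Theorems only; no `decide`, no certificate, no named fact, no `sorry`; `Interfaces.lean` (C1), every E term,
B01, `Transposition/*` untouched.  HONEST FRAMING: `HC_CM` is NOT proved, here or anywhere in the tree; this file proves no face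
period; its headline is CONDITIONAL on period witnesses for the listed faces.
T5: n/a-class — the only hypotheses of the headline are period witnesses on the faces of `𝒮` (instances of the crux B01-S), refuted
nowhere on the universe of record, plus the ordinary `IsProductOf` / `AVDominatedBy` data; no named-fact / conjecture-def binder;
checker: self (prover-pub-hodgecm2-b09-g27-0), 2026-08-22.

THE THEOREM (§3, `exists_faceBasis_hgen`).  For every Galois number field `F` and base embedding `σ₀` there is a finite set `𝒮` of
faces of `F` with `|𝒮| + n ≤ 2^{n−1}`, `n = [F:ℚ]/2` — the faces `F(𝟙_Q; i_Q, j_Q)` of part I for a base place and a selector,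
realised as `faceOfG` — such that the generation binder `hgen(𝒮, σ₀)` of INT2-GEN (`CorCM/FacePeriodsGeneratingSet.lean`) holds: the
`σ₀`-Weil character of EVERY face of `F` is an integer combination of the `σ₀`-Weil characters of the faces of `𝒮` (part I's
`exists_coords` pulled back through `vecOf`, then b23's pre-quotient socket `hgen_of_weightRel_mem_span`).  No census, no
certificate, no enumeration of `Gal(F/ℚ)`, every degree at once.
THE HEADLINE (§4, `hodgeConjectureFor_of_avDominatedBy_isProductOf_of_exists_facePeriod_faceBasis`, BY NAME over b23's
`hodgeConjectureFor_of_avDominatedBy_isProductOf_of_exists_facePeriod_on`).  For ONE Galois CM field `K` with `6 ≤ [K:ℚ] = 2n` and a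
base embedding: there are at most `2^{n−1} − n` faces of `K` such that ONE period witness on each of them on the universe of record
implies the Hodge conjecture, in every codimension, for every complex abelian variety dominated by a finite product of abelian
varieties realising CM types of CM fields embeddable in `K`.  (Per-type census rows `μ(G,c)` of `Census/*` are much smaller — `51`
orbits against `502` faces at degree `20` — but exist degree by degree; this is the certificate-free statement for all degrees.
FRAMING: conditional on those periods; `HC_CM` is not proved.)

## References
* [Pohlmann1968] H. Pohlmann, Algebraic cycles on abelian varieties of complex multiplication type, Ann. of Math. 88 (1968), Thm 1.
* [Milne1999LefschetzClasses] J. S. Milne, Lefschetz classes on abelian varieties, Duke Math. J. 96 (1999), Thm. 3.2.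
* [Shimura1998] G. Shimura, Abelian varieties with complex multiplication and modular functions, §6.2 Theorem 3.
-/

noncomputable section

open NumberField NumberField.ComplexEmbedding

namespace Summit.HodgeConjecture.CorCM.FaceBasis

open Literature.AlgebraicGeometry.Motives (CMType)
open Literature.NumberTheory.ComplexMultiplication.CMTypeOps
open Summit.HodgeConjecture.CorCM.Prior.AllgGroup.RfwfAllgGroup
open Summit.HodgeConjecture.CorCM.Census.OddSliceFacesModel (Ty hodge pairs pairVec)
open Summit.HodgeConjecture.CorCM.Census.OddSliceFacesSquares (faceVec faceVec_mem)
open Summit.HodgeConjecture.CorCM.Census.GroupFreeFaceBasis (BIdx bvec exists_selector exists_coords)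
open Summit.HodgeConjecture.CorCM.Census.GroupFreeFaceCoordinates (card_BIdx_add)

variable {F : Type} [Field F] [NumberField F]

/-- `n ≤ 2^{n−1}` (the count of the empty family). [folklore] -/
theorem le_two_pow_pred (n : ℕ) : n ≤ 2 ^ (n - 1) := by
  rcases n with _ | m
  · simp
  · rw [Nat.add_sub_cancel]
    induction m with
    | zero => simp
    | succ k ih => rw [pow_succ]; omega

/-! ## §3 The face basis generates the Weil characters of all faces (`hgen` with no census) -/

/-- **`hgen` FROM THE BASIS FACES, explicit family.**  For a base abstract CM type `T₀`, a base place `i₀ ∈ T₀` and ANY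
two-place selector, the `σ₀`-Weil character of EVERY face of `F` is an integer combination of the `σ₀`-Weil characters of the
`2^{n−1} − n` basis faces `basisFace σ₀ T₀ hsel Q`, `Q ∈ BIdx (Pl T₀) i₀` — a fortiori `hgen` of INT2-GEN holds for that family. [folklore] -/
theorem basisFace_hgen [IsGalois ℚ F] (σ₀ : F →+* ℂ) (T₀ : CMF (GalT F) conjT) {sel : Finset (Pl T₀) → Pl T₀ × Pl T₀}
    (hsel : ∀ Q : Finset (Pl T₀), 1 < Q.card → (sel Q).1 ∈ Q ∧ (sel Q).2 ∈ Q ∧ (sel Q).1 ≠ (sel Q).2) (i₀ : Pl T₀)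
    (f : Face F) :
    lefChar f.corner (fun _ => ({σ₀} : Finset (F →+* ℂ))) ∈ AddSubgroup.closure
      {a : Asym F | ∃ g ∈ Set.range (basisFace σ₀ T₀ hsel (i₀ := i₀)),
        ∃ σ : F →+* ℂ, a = lefChar g.corner (fun _ => ({σ} : Finset (F →+* ℂ)))} := by
  classical
  refine hgen_of_weightRel_mem_span _ σ₀ (fun f => ?_) f
  obtain ⟨c, hc⟩ := exists_coords (Pl T₀) i₀ hsel (vecOf_weightRel_corner_mem_hodge T₀ f σ₀)
  -- pull the coordinate identity back through `vecOf`
  set w : CMF (GalT F) conjT →₀ ℤ :=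
    ∑ Q, c Q • weightRel (basisFace σ₀ T₀ hsel Q).corner (fun _ => ({σ₀} : Finset (F →+* ℂ))) with hw
  have hvw : vecOf T₀ w = ∑ Q, c Q • bvec (Pl T₀) sel Q.1 := by
    rw [hw, map_sum]
    exact Finset.sum_congr rfl fun Q _ => by rw [map_smul, vecOf_weightRel_basisFace]
  have hP : weightRel f.corner (fun _ => ({σ₀} : Finset (F →+* ℂ))) - w ∈ pairRel := by
    have hmem : vecOf T₀ (weightRel f.corner (fun _ => ({σ₀} : Finset (F →+* ℂ))) - w) ∈
        (pairRel (F := F)).map (vecOf T₀ : (CMF (GalT F) conjT →₀ ℤ) →ₗ[ℤ] (Ty (Pl T₀) → ℤ)) := by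
      rw [map_pairRel_eq, map_sub, hvw]; exact hc
    obtain ⟨y, hy, hyx⟩ := hmem
    rw [LinearEquiv.coe_coe] at hyx
    rwa [← (vecOf T₀).injective hyx]
  have hW : w ∈ Submodule.span ℤ {y : CMF (GalT F) conjT →₀ ℤ |
      ∃ g ∈ Set.range (basisFace σ₀ T₀ hsel (i₀ := i₀)),
        ∃ σ : F →+* ℂ, y = weightRel g.corner (fun _ => ({σ} : Finset (F →+* ℂ)))} := by
    rw [hw]
    exact Submodule.sum_mem _ fun Q _ =>
      Submodule.smul_mem _ _ (Submodule.subset_span ⟨basisFace σ₀ T₀ hsel Q, ⟨Q, rfl⟩, σ₀, rfl⟩)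
  have e : weightRel f.corner (fun _ => ({σ₀} : Finset (F →+* ℂ))) =
      w + (weightRel f.corner (fun _ => ({σ₀} : Finset (F →+* ℂ))) - w) := by abel
  rw [e]
  exact Submodule.add_mem _ (Submodule.mem_sup_left hW) (Submodule.mem_sup_right hP)

/-- **`hgen` FROM THE FACE BASIS.**  For every Galois number field `F` and base embedding `σ₀` there is a finite set `𝒮` of faces
with `|𝒮| + n ≤ 2^{n−1}` (`n = [F:ℚ]/2`; so `|𝒮| ≤ 2^{n−1} − n`) whose `σ₀`-Weil characters generate those of ALL faces of `F`:
the basis faces `F(𝟙_Q; i_Q, j_Q)` of `Census/GroupFreeFaceBasis.lean` realised as `faceOfG`.  No certificate, no enumeration of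
the Galois group, every degree. [folklore] -/
theorem exists_faceBasis_hgen [IsGalois ℚ F] (σ₀ : F →+* ℂ) :
    ∃ 𝒮 : Finset (Face F), 𝒮.card + Module.finrank ℚ F / 2 ≤ 2 ^ (Module.finrank ℚ F / 2 - 1) ∧
      ∀ f : Face F, lefChar f.corner (fun _ => ({σ₀} : Finset (F →+* ℂ))) ∈ AddSubgroup.closure
        {a : Asym F | ∃ g ∈ (𝒮 : Set (Face F)), ∃ σ : F →+* ℂ, a = lefChar g.corner (fun _ => ({σ} : Finset (F →+* ℂ)))} := by
  classical
  by_cases hF : Nonempty (Face F)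
  swap
  · refine ⟨∅, ?_, fun f => absurd ⟨f⟩ hF⟩
    rw [Finset.card_empty, zero_add]
    exact le_two_pow_pred _
  obtain ⟨f₀⟩ := hF
  -- the base type, the base place, a selector
  set T₀ : CMF (GalT F) conjT := pullType f₀.Φ σ₀ with hT₀
  let i₀ : Pl T₀ := rep T₀ (translate σ₀ f₀.p)
  haveI : Nonempty (Pl T₀) := ⟨i₀⟩
  obtain ⟨sel, hsel⟩ := exists_selector (Pl T₀)
  refine ⟨Finset.univ.image (basisFace σ₀ T₀ hsel (i₀ := i₀)), ?_, ?_⟩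
  swap
  · rw [Finset.coe_image, Finset.coe_univ, Set.image_univ]
    exact basisFace_hgen σ₀ T₀ hsel i₀
  -- the count
  have hn : Module.finrank ℚ F / 2 = Fintype.card (Pl T₀) := by
    rw [← FaceCensus.card_galT (F := F), ← two_mul_card T₀]; omega
  rw [hn]
  calc (Finset.univ.image (basisFace σ₀ T₀ hsel (i₀ := i₀))).card + Fintype.card (Pl T₀)
      ≤ Fintype.card (BIdx (Pl T₀) i₀) + Fintype.card (Pl T₀) :=
        Nat.add_le_add_right (Finset.card_image_le.trans (by rw [Finset.card_univ])) _
    _ = 2 ^ (Fintype.card (Pl T₀) - 1) := card_BIdx_add (Pl T₀) i₀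

end Summit.HodgeConjecture.CorCM.FaceBasis

namespace Summit.HodgeConjecture.CorCM

open CategoryTheory
open Literature.AlgebraicGeometry Literature.AlgebraicGeometry.Motives Literature.AlgebraicGeometry.HodgeTheory
open Literature.AlgebraicGeometry.ComplexMultiplication Literature.AlgebraicGeometry.Milne1999
open Literature.NumberTheory.Automorphic
open Literature.NumberTheory.Automorphic.PicardCM
open Summit.HodgeConjecture.CorCM.Domination

/-! ## §4 The headline: INT-2 for the `F`-slice from at most `2^{n−1} − n` period witnesses, BY NAME over INT2-GEN -/

/-- **INT-2 WITH NO CENSUS (headline).**  For ONE Galois CM field `K` with `6 ≤ [K:ℚ] = 2n` and a base embedding `σ₀` there is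
a finite set `𝒮` of at most `2^{n−1} − n` faces of `K` — the basis faces `F(𝟙_Q; i_Q, j_Q)` — such that ONE period witness per
face OF `𝒮` on the universe of record (some admissible `ι₁`, some hermitian 3-space `V`, eigenforms at some `σ`) implies the Hodge
conjecture, in every codimension, for every complex abelian variety `A` dominated by a finite product of abelian varieties each
realising a CM type of a CM field `E` with `E →+* K`.  (FRAMING: a statement about ONE field `K`, CONDITIONAL on those `≤ 2^{n−1} − n`
periods; `HC_CM` is not proved.) [cite: Pohlmann1968, Thm. 1] [cite: Milne1999LefschetzClasses, Thm. 3.2 and Cor. 4.5]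
[cite: Shimura1998, §6.2 Theorem 3 and §6.1 Corollary of Theorem 2 (pp. 41–43)] -/
theorem hodgeConjectureFor_of_avDominatedBy_isProductOf_of_exists_facePeriod_faceBasis (K : CMField) [hGal : IsGalois ℚ K]
    (h6 : 6 ≤ Module.finrank ℚ K) (σ₀ : (K : Type) →+* ℂ) :
    ∃ 𝒮 : Finset (Face K), 𝒮.card + Module.finrank ℚ K / 2 ≤ 2 ^ (Module.finrank ℚ K / 2 - 1) ∧
      ((∀ f ∈ 𝒮, ∃ ι₁ : K →+* ℂ, f.Admissible ι₁ ∧ ∃ (V : HermSpace3 K ι₁) (σ : K →+* ℂ),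
        (Model.picardCMUniverse exists_isReal_hodgeModel_holds hodgePQ_independent_of_hodgeModel_holds
          BallQuotient.ballQuotientUniformised_holds cmAbelianVarietyRealised_holds).PeriodNV ι₁ V K f.psi σ) →
      ∀ {P A : AbelianVariety ℂ}, AbelianVariety.IsProductOf (fun B : AbelianVariety ℂ =>
        ∃ (E : Type) (_ : Field E) (_ : NumberField E) (_ : IsCMField E) (_ : E →+* (K : Type)) (Φ : CMType E)
          (ι : 𝓞 E →+* End B) (θ : E →+* Module.End ℂ (complexBetti B.X 1)),
          IsCMTypeRealisation Φ B ι θ) P →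
        AVDominatedBy A P → HodgeConjectureFor A.dim A.X) := by
  obtain ⟨𝒮, hcard, hgen⟩ := FaceBasis.exists_faceBasis_hgen (F := K) σ₀
  exact ⟨𝒮, hcard, fun hwit P A hP hA =>
    hodgeConjectureFor_of_avDominatedBy_isProductOf_of_exists_facePeriod_on K h6 (𝒮 : Set (Face K)) σ₀ hgen
      (fun f hf => hwit f hf) hP hA⟩

end Summit.HodgeConjecture.CorCM

end
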